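import Summits.NavierStokesRegularity.NavierStokesRegularity.Theorems.EulerZoomLiouvillePowerGaugeEulerLiouvilleEnergySaturationLoc

/-!
# Crux `EulerZoomLiouville.PowerGaugeEulerLiouville` (stmt-NavierStokesRegularity-19832), line `logtime-breathers`:
# ONE-SIDED SCALE-ODE RIGIDITY for WEAK profiles — a weak solution of the generalised profile energy INEQUALITY with
# large-scale class data, `β < 0` and `κ + 1 < 2ρ` vanishes a.e.

Width seat `ns-ezl-w4` (g3; breather rigidity, file IX: the WEAK and ONE-SIDED form of file VIII
`ClassicalProfile.eq_zero_of_locData_of_scaleODE`).  Let `V : ℝ³ → ℝ³` have a weak derivative `G` on the whole space, let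
`P` be a (measurable) pressure profile, and suppose `(V, G, P)` carry the thresholded large-scale class data (A₁), (E₁), (D₁) of
`EnergySaturation.exists_fluxWeight_le_of_sup_loc` (`0 < ρ < 1`) and the weak pressure Poisson equation `∫ P Δθ = −∫ D²θ(V,V)`.
Suppose that for EVERY nonnegative test function `σ` and every scale `L > 0` the ONE-SIDED cut-off energy inequality

  `κβ ∫σ(L⁻¹y)|V|² ≤ F_σ(L) + β ∫|V|²⟪y, ∇σ_L⟫`,   `F_σ(L) = ∫(|V|² + 2P)⟪V, ∇σ_L⟫`,  `σ_L = σ(L⁻¹·)`,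

holds with `β < 0`.  If `κ + 1 − 2ρ < 0` then `V = 0` a.e.

This is exactly what the local energy INEQUALITY of a suitable weak member delivers for a shape-preserving member whose clock
has `β < 0` — the log-time breather `u = e^{cτ}V(e^{−cτ}y)` with `c > 0` (`(α,β) = (c,−c)`, `κ = −5`): the co-moving test function
`η(τ)σ(e^{−cτ}y/L)` turns CKN (2.5) into the displayed inequality with a time-averaged pressure profile (sequel files
`…BreatherWeakLEI`, `…BreatherWeakRigidity`).  Proof: since `∫|V|²⟪y,∇σ_L⟫ = −L (d/dL)∫σ_L|V|²`
(`EnergySaturation.hasDerivAt_cutoffEnergy`), the inequality reads `β (κ I + L I') ≤ F_σ`, i.e. (β < 0)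
`(L^κ I)' ≥ β⁻¹ L^{κ−1} F_σ ≥ −|β|⁻¹ L^{κ−1}|F_σ|`; with the flux bound `|F_σ(r)| ≲ S^{1/2} r^{1−2ρ−a}` (`a = (2+ρ)/4`,
`EnergySaturation.exists_fluxWeight_le_of_sup_loc`) the function `L ↦ L^κ I(L) − B₀ S^{1/2} L^{e+1}` is MONOTONE
(`monotoneOn_of_hasDerivWithinAt_nonneg`), the boundary term `L^κ I(L) ≤ 3c' L^{κ+1−2ρ} → 0` dies at infinity, and the absorption
`S ≤ B₀ S^{1/2} L^{−a}` of `EnergySaturation.ae_eq_zero_of_subExtremal_loc` forces `∫_{B_L}|V|² ≲ L^{1−2ρ−2a} → 0`.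
No energy EQUALITY, no continuity of `V`, no sign of `κ` is used.

* `WeakProfile.ae_eq_zero_of_locData_of_scaleIneq` — the theorem above.

WHAT THIS IS NOT: not NS regularity, not the crux — a rigidity lemma for weak shape-preserving members of the crux CLASS 19832
(MODEL lattice); `--supports` stmt-19832. [folklore]
-/

noncomputable section

set_option linter.dupNamespace false

open MeasureTheory Set Filter Topology Metric Function TopologicalSpace
open scoped ENNReal NNReal RealInnerProductSpace ContDiff Laplacian

namespace Summit.NavierStokesRegularity.NavierStokesRegularity.Theorems.PowerGaugeEulerLiouville

open Literature.Analysis Literature.Analysis.FunctionSpaces Literature.Analysis.FluidPDE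

namespace WeakProfile

variable {V : EuclideanSpace ℝ (Fin 3) → EuclideanSpace ℝ (Fin 3)} {P : EuclideanSpace ℝ (Fin 3) → ℝ}
  {G : EuclideanSpace ℝ (Fin 3) → EuclideanSpace ℝ (Fin 3) →L[ℝ] EuclideanSpace ℝ (Fin 3)}

/-- **ONE-SIDED SCALE-ODE RIGIDITY for weak profiles.**  Let `V` have the weak derivative `G` on `ℝ³`, `P` measurable, with, for
`L ≥ 1`, `∫_{B_L}|V|² ≤ c' L^{1−2ρ}`, `∫_{B_L}|G|²_F ≤ L^{1−ρ}((1−ρ)/(2+ρ))c'`, `∫_{B_L}|P|^{3/2} ≤ L^{2−2ρ}((2−2ρ)/(2+ρ))c'` (`0 < ρ < 1`),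
the weak Poisson equation `∫ P Δθ = −∫ D²θ(V,V)`, and the one-sided cut-off energy inequality
`κβ ∫σ(L⁻¹y)|V|² ≤ ∫(|V|²+2P)⟪V,∇σ_L⟫ + β ∫|V|²⟪y,∇σ_L⟫` for every nonnegative test function `σ` and every `L > 0`, with `β < 0`.
If `κ + 1 − 2ρ < 0`, then `V = 0` a.e. [folklore] -/
theorem ae_eq_zero_of_locData_of_scaleIneq {ρ : ℝ} (hρ : 0 < ρ) (hρ1 : ρ < 1)
    (hVm : AEStronglyMeasurable V volume) (hPm : AEStronglyMeasurable P volume)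
    (hGm : AEStronglyMeasurable G volume)
    (hVG : HasWeakFDerivOn (⊤ : Opens (EuclideanSpace ℝ (Fin 3))) volume V G)
    {β κ : ℝ} (hβ : β < 0) (hκ : κ + 1 - 2 * ρ < 0) {c' : ℝ≥0}
    (hA : ∀ L : ℝ, 1 ≤ L → ∫⁻ y in ball (0 : EuclideanSpace ℝ (Fin 3)) L, ‖V y‖ₑ ^ 2 ≤
      (c' : ℝ≥0∞) * ENNReal.ofReal (L ^ (1 - 2 * ρ)))
    (hE : ∀ L : ℝ, 1 ≤ L →
      ∫⁻ y in ball (0 : EuclideanSpace ℝ (Fin 3)) L, ENNReal.ofReal (frobeniusNormSq (G y)) ≤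
        ENNReal.ofReal (L ^ (1 - ρ)) * (ENNReal.ofReal ((1 - ρ) / (2 + ρ)) * (c' : ℝ≥0∞)))
    (hD : ∀ L : ℝ, 1 ≤ L →
      ∫⁻ y in ball (0 : EuclideanSpace ℝ (Fin 3)) L, ‖P y‖ₑ ^ (3 / 2 : ℝ) ≤
        ENNReal.ofReal (L ^ (2 - 2 * ρ)) * (ENNReal.ofReal ((2 - 2 * ρ) / (2 + ρ)) * (c' : ℝ≥0∞)))
    (hPoisson : ∀ θ : EuclideanSpace ℝ (Fin 3) → ℝ, ContDiff ℝ (⊤ : ℕ∞) θ → HasCompactSupport θ →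
      ∫ y, P y * (Δ θ) y = -∫ y, fderiv ℝ (fderiv ℝ θ) y (V y) (V y))
    (hLE : ∀ σ : EuclideanSpace ℝ (Fin 3) → ℝ, IsTestFunctionOn (⊤ : Opens (EuclideanSpace ℝ (Fin 3))) σ →
      (∀ z, 0 ≤ σ z) → ∀ L : ℝ, 0 < L →
        κ * β * ∫ x, σ (L⁻¹ • x) * ‖V x‖ ^ 2 ≤
          (∫ x, (‖V x‖ ^ 2 + 2 * P x) * ⟪V x, gradient (fun z => σ (L⁻¹ • z)) x⟫) +
            β * ∫ x, ‖V x‖ ^ 2 * ⟪x, gradient (fun z => σ (L⁻¹ • z)) x⟫) :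
    V =ᵐ[volume] 0 := by
  -- adapted from `ClassicalProfile.eq_zero_of_locData_of_scaleODE` (…ClassicalProfileRigidity, ns-ezl-w4 g2)
  have h2ρ : (0 : ℝ) < 2 + ρ := by linarith
  have hc0 : (0 : ℝ) ≤ c' := c'.2
  have hβ0 : β ≠ 0 := hβ.ne
  have hV2 : LocallyIntegrable (fun y => ‖V y‖ ^ 2) volume :=
    EnergySaturation.locallyIntegrable_norm_sq_of_growth_loc hVm hA
  -- ### the radial cut-off
  obtain ⟨σ, hσs, hσc, h0, h1, hone, hzero, -⟩ := exists_radialCutoff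
  have hσ : IsTestFunctionOn (⊤ : Opens (EuclideanSpace ℝ (Fin 3))) σ := ⟨hσs, hσc, fun _ _ => trivial⟩
  have hσ1 : ContDiff ℝ 1 σ := hσs.of_le (by exact_mod_cast le_top)
  have hσd : Differentiable ℝ σ := hσ1.differentiable one_ne_zero
  -- ### the cut-off energy `I`, its scale derivative `I'`, and the scale ODE inequality
  set I : ℝ → ℝ := fun L => ∫ y, σ (L⁻¹ • y) * ‖V y‖ ^ 2 with hIdef
  set I' : ℝ → ℝ := fun L => ∫ y, (-(L ^ 2)⁻¹ * fderiv ℝ σ (L⁻¹ • y) y) * ‖V y‖ ^ 2 with hI'def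
  have hODE : ∀ L : ℝ, 0 < L →
      HasDerivAt (fun L : ℝ => L ^ κ * I L) (κ * L ^ (κ - 1) * I L + L ^ κ * I' L) L ∧
        β⁻¹ * L ^ (κ - 1) * (∫ x, (‖V x‖ ^ 2 + 2 * P x) * ⟪V x, gradient (fun z => σ (L⁻¹ • z)) x⟫) ≤
          κ * L ^ (κ - 1) * I L + L ^ κ * I' L := by
    intro L hL
    obtain ⟨-, hId⟩ := EnergySaturation.hasDerivAt_cutoffEnergy hσ1 hσc hVm hV2 hL
    have hpow : HasDerivAt (fun L : ℝ => L ^ κ) (κ * L ^ (κ - 1)) L :=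
      Real.hasDerivAt_rpow_const (Or.inl hL.ne')
    refine ⟨hpow.mul hId, ?_⟩
    set F : ℝ := ∫ x, (‖V x‖ ^ 2 + 2 * P x) * ⟪V x, gradient (fun z => σ (L⁻¹ • z)) x⟫ with hF
    have heuler : ∫ x, ‖V x‖ ^ 2 * ⟪x, gradient (fun z => σ (L⁻¹ • z)) x⟫ = -L * I' L := by
      rw [hI'def, ← integral_const_mul]
      refine integral_congr_ae (Eventually.of_forall fun y => ?_)
      show ‖V y‖ ^ 2 * ⟪y, gradient (fun z => σ (L⁻¹ • z)) y⟫ =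
        -L * (-(L ^ 2)⁻¹ * fderiv ℝ σ (L⁻¹ • y) y * ‖V y‖ ^ 2)
      rw [EnergySaturation.inner_self_gradient_comp_inv_smul hσd, map_smul, smul_eq_mul]
      field_simp
    have hle := hLE σ hσ h0 L hL
    rw [heuler] at hle
    -- `β (κ I + L I') ≤ F`, `β < 0` ⇒ `κ I + L I' ≥ F/β`
    have h1' : β * (κ * I L + L * I' L) ≤ F := by
      have : κ * β * I L ≤ F + β * (-L * I' L) := hle
      nlinarith [this]
    have h2' : β⁻¹ * F ≤ κ * I L + L * I' L := by
      have hβinv : β⁻¹ < 0 := inv_lt_zero.2 hβ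
      have := mul_le_mul_of_nonpos_left h1' hβinv.le
      rwa [← mul_assoc, inv_mul_cancel₀ hβ0, one_mul] at this
    have hLκ : 0 ≤ L ^ (κ - 1) := Real.rpow_nonneg hL.le _
    have e2 : L ^ κ = L ^ (κ - 1) * L := by
      rw [show κ = (κ - 1) + 1 by ring, Real.rpow_add hL, Real.rpow_one]; ring_nf
    calc β⁻¹ * L ^ (κ - 1) * F = L ^ (κ - 1) * (β⁻¹ * F) := by ring
      _ ≤ L ^ (κ - 1) * (κ * I L + L * I' L) := mul_le_mul_of_nonneg_left h2' hLκ
      _ = κ * L ^ (κ - 1) * I L + L ^ κ * I' L := by rw [e2]; ring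
  -- ### the normalised energy `N`
  set N : ℝ → ℝ := fun R => R ^ (2 * ρ - 1) * ∫ y, σ (R⁻¹ • y) * ‖V y‖ ^ 2 with hN
  have hI0 : ∀ R : ℝ, 0 ≤ ∫ y, σ (R⁻¹ • y) * ‖V y‖ ^ 2 := fun R =>
    integral_nonneg fun y => mul_nonneg (h0 _) (sq_nonneg _)
  have hN0 : ∀ R, 0 < R → 0 ≤ N R := fun R hR => mul_nonneg (Real.rpow_nonneg hR.le _) (hI0 R)
  have hN3 : ∀ R, 1 ≤ R → N R ≤ 3 * c' := by
    intro R hR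
    have h := EnergySaturation.normEnergy_le_of_growth_loc (ρ := ρ) h0 h1 hzero hVm hA hR
    have h3 : (3 : ℝ) ^ (1 - 2 * ρ) ≤ 3 := by
      conv_rhs => rw [← Real.rpow_one 3]
      exact Real.rpow_le_rpow_of_exponent_le (by norm_num) (by linarith)
    exact h.trans (by gcongr)
  -- ### the flux bound of the energy-saturation chain
  obtain ⟨A, hA0, hflux⟩ := EnergySaturation.exists_fluxWeight_le_of_sup_loc hρ hρ1 hσ h0 h1 hone hzero hVm hPm hGm hVG
    hA hE hD hPoisson
  set a : ℝ := (2 + ρ) / 4 with hadef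
  have ha0 : 0 < a := by rw [hadef]; positivity
  have hcabs : 0 < |β| := abs_pos.2 hβ0
  set e : ℝ := κ - a - 2 * ρ with hedef
  have he1 : e + 1 < 0 := by rw [hedef]; linarith
  set K : ℝ := A / ((2 + ρ) * |β|) with hK
  have hK0 : 0 ≤ K := by rw [hK]; positivity
  set B₀ : ℝ := K / (-(e + 1)) with hB₀
  have hB₀0 : 0 ≤ B₀ := div_nonneg hK0 (by linarith)
  have hB₀e : B₀ * (e + 1) = -K := by
    have hne : -(e + 1) ≠ 0 := by intro h; linarith
    rw [hB₀, div_mul_eq_mul_div, div_eq_iff hne]; ring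
  -- ### KEY (the scale ODE): an admissible `S` on `[L, ∞)` gives `N(R) ≤ B₀ S^{1/2} L^{-a}` on `[L, ∞)`
  have hkey : ∀ L : ℝ, 1 ≤ L → ∀ S : ℝ, 0 ≤ S → S ≤ 3 * c' → (∀ R, L ≤ R → N R ≤ S) →
      ∀ R, L ≤ R → N R ≤ B₀ * S ^ (1 / 2 : ℝ) * L ^ (-a) := by
    intro L hL S hS hS3 hSsup R hR
    have hL0 : 0 < L := lt_of_lt_of_le one_pos hL
    have hR0 : 0 < R := lt_of_lt_of_le hL0 hR
    have hR1 : 1 ≤ R := hL.trans hR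
    have hS12 : 0 ≤ S ^ (1 / 2 : ℝ) := Real.rpow_nonneg hS _
    have hsup' : ∀ R' : ℝ, L ≤ R' → ∫ y, σ (R'⁻¹ • y) * ‖V y‖ ^ 2 ≤ R' ^ (1 - 2 * ρ) * S := by
      intro R' hR'
      have hR'0 : 0 < R' := lt_of_lt_of_le hL0 hR'
      have h := hSsup R' hR'
      have hRR : R' ^ (1 - 2 * ρ) * R' ^ (2 * ρ - 1) = 1 := by rw [← Real.rpow_add hR'0]; norm_num
      calc ∫ y, σ (R'⁻¹ • y) * ‖V y‖ ^ 2 = R' ^ (1 - 2 * ρ) * N R' := by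
            simp only [hN]; rw [← mul_assoc, hRR, one_mul]
        _ ≤ R' ^ (1 - 2 * ρ) * S := mul_le_mul_of_nonneg_left h (Real.rpow_nonneg hR'0.le _)
    have hfl := hflux S hS hS3 L hL hsup'
    -- the scale-ODE right-hand side is `≥ -K S^{1/2} r^e` on `[L, ∞)`
    have hbound : ∀ r : ℝ, L ≤ r → -(K * S ^ (1 / 2 : ℝ) * r ^ e) ≤ β⁻¹ * r ^ (κ - 1) *
        ∫ x, (‖V x‖ ^ 2 + 2 * P x) * ⟪V x, gradient (fun z => σ (r⁻¹ • z)) x⟫ := by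
      intro r hr
      have hr0 : 0 < r := lt_of_lt_of_le hL0 hr
      set F : ℝ := ∫ x, (‖V x‖ ^ 2 + 2 * P x) * ⟪V x, gradient (fun z => σ (r⁻¹ • z)) x⟫ with hF
      have hfr := hfl r hr
      have hpos : 0 < (2 + ρ) * r ^ (2 * ρ - 2) := by positivity
      have hFle : |F| ≤ A * S ^ (1 / 2 : ℝ) * r ^ (-1 - (2 + ρ) / 4) / ((2 + ρ) * r ^ (2 * ρ - 2)) := by
        rw [le_div_iff₀ hpos]
        have : |(2 + ρ) * r ^ (2 * ρ - 2) * F| = |F| * ((2 + ρ) * r ^ (2 * ρ - 2)) := by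
          rw [abs_mul, abs_of_pos hpos, mul_comm]
        rw [← this]
        exact hfr
      have hexp : r ^ (κ - 1) * r ^ (-1 - (2 + ρ) / 4) / r ^ (2 * ρ - 2) = r ^ e := by
        rw [← Real.rpow_add hr0, ← Real.rpow_sub hr0, hedef, hadef]
        congr 1; ring
      have habs : |β⁻¹ * r ^ (κ - 1) * F| ≤ K * S ^ (1 / 2 : ℝ) * r ^ e := by
        rw [abs_mul, abs_mul, abs_inv, abs_of_pos (Real.rpow_pos_of_pos hr0 _)]
        calc |β|⁻¹ * r ^ (κ - 1) * |F|
            ≤ |β|⁻¹ * r ^ (κ - 1) * (A * S ^ (1 / 2 : ℝ) * r ^ (-1 - (2 + ρ) / 4) / ((2 + ρ) * r ^ (2 * ρ - 2))) :=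
              mul_le_mul_of_nonneg_left hFle (by positivity)
          _ = K * S ^ (1 / 2 : ℝ) * (r ^ (κ - 1) * r ^ (-1 - (2 + ρ) / 4) / r ^ (2 * ρ - 2)) := by
              rw [hK]
              field_simp
          _ = K * S ^ (1 / 2 : ℝ) * r ^ e := by rw [hexp]
      exact neg_le_of_abs_le habs
    -- MONOTONICITY of `g(r) = r^κ I(r) - B₀ S^{1/2} r^{e+1}` on `[L, ∞)`
    set g : ℝ → ℝ := fun r => r ^ κ * I r - B₀ * S ^ (1 / 2 : ℝ) * r ^ (e + 1) with hg
    set g' : ℝ → ℝ := fun r => (κ * r ^ (κ - 1) * I r + r ^ κ * I' r) -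
      B₀ * S ^ (1 / 2 : ℝ) * ((e + 1) * r ^ (e + 1 - 1)) with hg'
    have hgderiv : ∀ r : ℝ, 0 < r → HasDerivAt g (g' r) r := by
      intro r hr0
      have hp : HasDerivAt (fun r : ℝ => B₀ * S ^ (1 / 2 : ℝ) * r ^ (e + 1))
          (B₀ * S ^ (1 / 2 : ℝ) * ((e + 1) * r ^ (e + 1 - 1))) r :=
        (Real.hasDerivAt_rpow_const (Or.inl hr0.ne')).const_mul _
      exact (hODE r hr0).1.sub hp
    have hg'pos : ∀ r : ℝ, L ≤ r → 0 ≤ g' r := by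
      intro r hr
      have hr0 : 0 < r := lt_of_lt_of_le hL0 hr
      have hb := hbound r hr
      have hD := (hODE r hr0).2
      have hsimp : B₀ * S ^ (1 / 2 : ℝ) * ((e + 1) * r ^ (e + 1 - 1)) = -(K * S ^ (1 / 2 : ℝ) * r ^ e) := by
        rw [show e + 1 - 1 = e by ring]
        calc B₀ * S ^ (1 / 2 : ℝ) * ((e + 1) * r ^ e) = (B₀ * (e + 1)) * S ^ (1 / 2 : ℝ) * r ^ e := by ring
          _ = -(K * S ^ (1 / 2 : ℝ) * r ^ e) := by rw [hB₀e]; ring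
      simp only [hg']
      rw [hsimp]
      linarith
    have hmono : MonotoneOn g (Ici L) := by
      have hcont : ContinuousOn g (Ici L) := fun r hr =>
        (hgderiv r (lt_of_lt_of_le hL0 hr)).continuousAt.continuousWithinAt
      refine monotoneOn_of_hasDerivWithinAt_nonneg (f' := g') (convex_Ici L) hcont (fun r hr => ?_) (fun r hr => ?_)
      · rw [interior_Ici] at hr ⊢
        exact (hgderiv r (hL0.trans hr)).hasDerivWithinAt
      · rw [interior_Ici] at hr
        exact hg'pos r (le_of_lt hr)
    -- the boundary term at `∞` vanishes: `R^{κ} I(R) ≤ B₀ S^{1/2} R^{e+1}`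
    have hI5 : R ^ κ * I R ≤ B₀ * S ^ (1 / 2 : ℝ) * R ^ (e + 1) := by
      refine le_of_forall_pos_lt_add fun ε hε => ?_
      have h42 : (0 : ℝ) < -(κ + 1 - 2 * ρ) := by linarith
      have htend : Tendsto (fun R' : ℝ => 3 * (c' : ℝ) * R' ^ (-(-(κ + 1 - 2 * ρ)))) atTop (𝓝 (3 * (c' : ℝ) * 0)) :=
        tendsto_const_nhds.mul (tendsto_rpow_neg_atTop h42)
      rw [mul_zero] at htend
      obtain ⟨R', hR'ε, hR'R⟩ := ((htend.eventually (gt_mem_nhds hε)).and (eventually_ge_atTop R)).exists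
      have hR'0 : 0 < R' := lt_of_lt_of_le hR0 hR'R
      have htail : R' ^ κ * I R' ≤ 3 * (c' : ℝ) * R' ^ (-(-(κ + 1 - 2 * ρ))) := by
        have hI := EnergySaturation.cutoffEnergy_le_three_loc hρ h0 h1 hzero hVm hA (hR1.trans hR'R)
        calc R' ^ κ * I R' ≤ R' ^ κ * (R' ^ (1 - 2 * ρ) * (3 * c')) :=
              mul_le_mul_of_nonneg_left hI (Real.rpow_nonneg hR'0.le _)
          _ = 3 * (c' : ℝ) * (R' ^ κ * R' ^ (1 - 2 * ρ)) := by ring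
          _ = 3 * (c' : ℝ) * R' ^ (-(-(κ + 1 - 2 * ρ))) := by
              rw [← Real.rpow_add hR'0]; congr 2; ring
      -- monotonicity between `R` and `R'`
      have hgm := hmono (show R ∈ Ici L from hR) (show R' ∈ Ici L from hR.trans hR'R) hR'R
      have hgm' : R ^ κ * I R - B₀ * S ^ (1 / 2 : ℝ) * R ^ (e + 1) ≤
          R' ^ κ * I R' - B₀ * S ^ (1 / 2 : ℝ) * R' ^ (e + 1) := hgm
      have hR'e : 0 ≤ B₀ * S ^ (1 / 2 : ℝ) * R' ^ (e + 1) :=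
        mul_nonneg (mul_nonneg hB₀0 hS12) (Real.rpow_nonneg hR'0.le _)
      linarith
    -- `N(R) = R^{2ρ-1-κ} · R^{κ} I(R) ≤ B₀ S^{1/2} R^{-a} ≤ B₀ S^{1/2} L^{-a}`
    have hsplit : R ^ (2 * ρ - 1) = R ^ (2 * ρ - 1 - κ) * R ^ κ := by
      rw [← Real.rpow_add hR0]; congr 1; ring
    have hea : R ^ (2 * ρ - 1 - κ) * R ^ (e + 1) = R ^ (-a) := by
      rw [← Real.rpow_add hR0, hedef]; congr 1; ring
    have hRa : R ^ (-a) ≤ L ^ (-a) := Real.rpow_le_rpow_of_nonpos hL0 hR (by linarith)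
    simp only [hN]
    calc R ^ (2 * ρ - 1) * ∫ y, σ (R⁻¹ • y) * ‖V y‖ ^ 2
        = R ^ (2 * ρ - 1 - κ) * (R ^ κ * I R) := by rw [hsplit, mul_assoc]
      _ ≤ R ^ (2 * ρ - 1 - κ) * (B₀ * S ^ (1 / 2 : ℝ) * R ^ (e + 1)) :=
          mul_le_mul_of_nonneg_left hI5 (Real.rpow_nonneg hR0.le _)
      _ = B₀ * S ^ (1 / 2 : ℝ) * (R ^ (2 * ρ - 1 - κ) * R ^ (e + 1)) := by ring
      _ = B₀ * S ^ (1 / 2 : ℝ) * R ^ (-a) := by rw [hea]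
      _ ≤ B₀ * S ^ (1 / 2 : ℝ) * L ^ (-a) := mul_le_mul_of_nonneg_left hRa (by positivity)
  -- ### ABSORPTION: the tail supremum on `[L, ∞)` is at most `B₀² L^{-2a}`
  -- (verbatim from `EnergySaturation.ae_eq_zero_of_subExtremal_loc`)
  have hdecay : ∀ L : ℝ, 1 ≤ L → N L ≤ B₀ ^ 2 * (L ^ (-a)) ^ 2 := by
    intro L hL
    have hL0 : 0 < L := lt_of_lt_of_le one_pos hL
    set T : Set ℝ := N '' Ici L with hT
    have hTne : T.Nonempty := ⟨N L, L, Set.self_mem_Ici, rfl⟩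
    have hTbdd : BddAbove T := ⟨3 * c', by
      rintro _ ⟨R, hR, rfl⟩; exact hN3 R (hL.trans (Set.mem_Ici.1 hR))⟩
    set S : ℝ := sSup T with hSdef
    have hSsup : ∀ R, L ≤ R → N R ≤ S := fun R hR => le_csSup hTbdd ⟨R, Set.mem_Ici.2 hR, rfl⟩
    have hS0 : 0 ≤ S := (hN0 L hL0).trans (hSsup L le_rfl)
    have hS3 : S ≤ 3 * c' := csSup_le hTne (by
      rintro _ ⟨R, hR, rfl⟩; exact hN3 R (hL.trans (Set.mem_Ici.1 hR)))
    have hSle : S ≤ B₀ * S ^ (1 / 2 : ℝ) * L ^ (-a) :=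
      csSup_le hTne (by rintro _ ⟨R, hR, rfl⟩; exact hkey L hL S hS0 hS3 hSsup R (Set.mem_Ici.1 hR))
    have habs := EnergySaturation.le_sq_of_le_mul_sqrt hS0 hB₀0 (Real.rpow_nonneg hL0.le _) hSle
    exact (hSsup L le_rfl).trans habs
  -- ### CONCLUSION: the energy of every ball vanishes (verbatim from `EnergySaturation.ae_eq_zero_of_subExtremal_loc`)
  have hballzero : ∀ L₀ : ℝ, 0 < L₀ → ∫⁻ y in ball (0 : EuclideanSpace ℝ (Fin 3)) L₀, ‖V y‖ₑ ^ 2 = 0 := by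
    intro L₀ hL₀
    refine le_antisymm (ENNReal.le_of_forall_pos_le_add fun δ hδ _ => ?_) zero_le
    rw [zero_add]
    have hexp : (1 - 2 * ρ) + -(2 * a) < 0 := by rw [hadef]; linarith
    have htend : Tendsto (fun L : ℝ => B₀ ^ 2 * L ^ ((1 - 2 * ρ) + -(2 * a))) atTop (𝓝 (B₀ ^ 2 * 0)) := by
      refine tendsto_const_nhds.mul ?_
      have := tendsto_rpow_neg_atTop (y := -((1 - 2 * ρ) + -(2 * a))) (by linarith)
      simpa using this
    rw [mul_zero] at htend
    have hev := (htend.eventually (gt_mem_nhds (show (0 : ℝ) < δ from hδ))).and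
      (eventually_ge_atTop (max L₀ 1))
    obtain ⟨L, hLδ, hLge⟩ := hev.exists
    have hL1 : 1 ≤ L := (le_max_right _ _).trans hLge
    have hL0 : 0 < L := lt_of_lt_of_le one_pos hL1
    have hLL₀ : L₀ ≤ L := (le_max_left _ _).trans hLge
    have h1 := EnergySaturation.lintegral_ball_sq_le_cutoffEnergy hσs.continuous hσc h0 hone hV2 hL0
    have hNL := hdecay L hL1
    have hI : ∫ y, σ (L⁻¹ • y) * ‖V y‖ ^ 2 ≤ B₀ ^ 2 * L ^ ((1 - 2 * ρ) + -(2 * a)) := by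
      have hRR : L ^ (1 - 2 * ρ) * L ^ (2 * ρ - 1) = 1 := by rw [← Real.rpow_add hL0]; norm_num
      have e2 : (L ^ (-a)) ^ 2 = L ^ (-(2 * a)) := by
        rw [← Real.rpow_natCast, ← Real.rpow_mul hL0.le]; norm_num; ring_nf
      calc ∫ y, σ (L⁻¹ • y) * ‖V y‖ ^ 2 = L ^ (1 - 2 * ρ) * N L := by
            simp only [hN]; rw [← mul_assoc, hRR, one_mul]
        _ ≤ L ^ (1 - 2 * ρ) * (B₀ ^ 2 * (L ^ (-a)) ^ 2) :=
            mul_le_mul_of_nonneg_left hNL (Real.rpow_nonneg hL0.le _)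
        _ = B₀ ^ 2 * (L ^ (1 - 2 * ρ) * L ^ (-(2 * a))) := by rw [e2]; ring
        _ = B₀ ^ 2 * L ^ ((1 - 2 * ρ) + -(2 * a)) := by rw [← Real.rpow_add hL0]
    calc ∫⁻ y in ball (0 : EuclideanSpace ℝ (Fin 3)) L₀, ‖V y‖ₑ ^ 2
        ≤ ∫⁻ y in ball (0 : EuclideanSpace ℝ (Fin 3)) L, ‖V y‖ₑ ^ 2 := lintegral_mono_set (ball_subset_ball hLL₀)
      _ ≤ ENNReal.ofReal (∫ y, σ (L⁻¹ • y) * ‖V y‖ ^ 2) := h1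
      _ ≤ ENNReal.ofReal (B₀ ^ 2 * L ^ ((1 - 2 * ρ) + -(2 * a))) := ENNReal.ofReal_le_ofReal hI
      _ ≤ (δ : ℝ≥0∞) := by
          rw [← ENNReal.ofReal_coe_nnreal]; exact ENNReal.ofReal_le_ofReal hLδ.le
  -- ### hence `V = 0` a.e.
  have hball_ae : ∀ n : ℕ, ∀ᵐ y ∂(volume.restrict (ball (0 : EuclideanSpace ℝ (Fin 3)) ((n : ℝ) + 1))), V y = 0 := by
    intro n
    have h := hballzero ((n : ℝ) + 1) (by positivity)
    rw [lintegral_eq_zero_iff' (hVm.restrict.enorm.pow_const 2)] at h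
    filter_upwards [h] with y hy
    simpa using hy
  have hunion : (⋃ n : ℕ, ball (0 : EuclideanSpace ℝ (Fin 3)) ((n : ℝ) + 1)) = univ := by
    refine eq_univ_of_forall fun y => mem_iUnion.2 ?_
    obtain ⟨n, hn⟩ := exists_nat_gt ‖y‖
    exact ⟨n, by rw [mem_ball, dist_zero_right]; linarith⟩
  have hVae := (ae_restrict_iUnion_iff (μ := (volume : Measure (EuclideanSpace ℝ (Fin 3))))
    (fun n : ℕ => ball (0 : EuclideanSpace ℝ (Fin 3)) ((n : ℝ) + 1)) (fun y => V y = 0)).2 hball_ae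
  rw [hunion, Measure.restrict_univ] at hVae
  exact hVae

end WeakProfile

end Summit.NavierStokesRegularity.NavierStokesRegularity.Theorems.PowerGaugeEulerLiouville

end
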